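import Summits.BirchSwinnertonDyer.BirchSwinnertonDyer.Theorems.SignedLowerHalvesSmallImageLowerHalfBothSignsRttD2J1CyclotomicCarrier
import HarnessLib

/-!
# Route `SignedLowerHalves`, crux L `SmallImageLowerHalfBothSigns` (stmt-BirchSwinnertonDyer-23599), line `rtt_w3` v14 — E2, junction rows (J1)/(J2), RIGIDITY OF THE PINS:
# on ANY pinned datum the action of EVERY power series `F ∈ Λ_{𝒪,2} = 𝒪⟦T₂⟧⟦T₁⟧` (resp. `Λ_𝒪 = 𝒪⟦T⟧`) is read on the levels through the CANONICAL level structure: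
# `proj n k (F • x) = F •_{level} proj n k x`

INPUTS hand `bsd-inputs-honda-p1` g23 under LEAD `cruxlead-stmt-BirchSwinnertonDyer-23599` g11 (BRIEF-E2 rev 5 §2 rows J1/J2; sequel of `…RttD2J1CyclotomicCarrier` p782087 and
`…RttD2J2Corestriction` p782174). WHY. The pins (P5)–(P7) of honda g22's `JohnsonLeungKings2011.IwasawaCohomologyDataO` (and of the one-variable twin
`SmallImageRttD2J1.CycIwasawaCohomologyDataO`) only name the action of the GENERATORS `T₁ = X`, `T₂ = C X` and of the constants `C (C c)` on the levels; every consumer that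
needs a map out of an ABSTRACT datum to be `Λ`-linear for ALL power series (the junction's `sp¹`, `j₀`; the comparison of two data) needs the action of a general
`F` on the levels. THIS FILE proves it is FORCED: with (P8) the quotient `H ⧸ ker (proj n k)` is a `Λ_{𝒪,2}`-module on which `T₁, T₂` act through the locally nilpotent
`conj_{γ_i} − 1` of the level (it embeds into the level group), so Kaplansky's statement (a) (tree `LocallyNilpotent.map_smul₂_of_comp_eq` / `map_smul_of_comp_eq`,
p776649) applied to the embedding gives ★★ `proj_smul_eq_layer_smul` (two variables) / ★★ `proj_smul_eq_cycLayer_smul` (one variable): `proj n k (F • x)` is `F` acting on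
`proj n k x` through the CONSTRUCTED level structure `layerModuleO₂` / `cycLayerModuleO` (`…CarriersOExist` p777117 / p782087). Corollary ★ `addMonoidHom_map_smul_of_proj`:
an additive map between two data with the same parameters that commutes with the projections is `Λ`-LINEAR (rigidity of the pinned data).
THEOREMS + transparent `letI`-recipes (module structures on the quotients by `compHom`); no named fact, no `sorry`; crux L, crux M, E2 and BSD remain OPEN and are
proved for NO curve by any of this. References: [Kaplansky1954] §19 (a); [Lang1990] Ch. 5 §1; [JohnsonLeungKings2011] §4.2 Def. 4.2 (94) (arXiv 0804.2828 p0012:L80–112);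
[Kato2004Asterisque] §8.2 (p. 180).
-/

set_option autoImplicit false
-- the Theorems namespace of this sub repeats the summit name by design (D-0017 nested layout)
set_option linter.dupNamespace false

noncomputable section

open scoped NumberField PowerSeries
open CategoryTheory Field IsDedekindDomain
open Literature.NumberTheory.GaloisRepresentations
open Literature.NumberTheory.EllipticCurves
open Literature.NumberTheory.ComplexMultiplication.EllipticUnits
open Literature.NumberTheory.ComplexMultiplication.EllipticUnits.JohnsonLeungKings2011
open Literature.Algebra.Module.LocallyNilpotent
open Summit.BirchSwinnertonDyer.BirchSwinnertonDyer.Theorems.SmallImageRttD2J1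

namespace Summit.BirchSwinnertonDyer.BirchSwinnertonDyer.Theorems.SmallImageRttD2J2

/-! ## §1 Two variables: honda's `IwasawaCohomologyDataO` -/

section TwoVar

variable {K : Type} [Field K] [NumberField K] {p : ℕ} [Fact p.Prime] {S : Set (PadicAlgCl p)}
  {κ₁ κ₂ : ZpExtension K p} {γ₁ γ₂ : absoluteGaloisGroup K} {θ : absoluteGaloisGroup K →ₜ* (padicCoeffIntegers S)ˣ} {𝔣 : Ideal (𝓞 K)}
  {i : ℕ} (hi : i ≤ 2) (D : IwasawaCohomologyDataO S κ₁ κ₂ γ₁ γ₂ θ 𝔣 i) (n k : ℕ)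

/-- The intermediate `𝒪⟦T₂⟧`-structure of the quotient `H ⧸ ker (proj n k)`: restriction along the constants `C : 𝒪⟦T₂⟧ → 𝒪⟦T₂⟧⟦T₁⟧` (activate with `letI`).
[cite: Lang1990, Ch. 5 §1] -/
@[reducible] def quotModuleInner : Module (PowerSeries (padicCoeffIntegers S)) (D.H ⧸ D.kerProj n k) :=
  Module.compHom _ (PowerSeries.C : PowerSeries (padicCoeffIntegers S) →+* IwasawaAlgebraO₂ S)

/-- The `𝒪`-structure of the quotient `H ⧸ ker (proj n k)`: restriction along `c ↦ C (C c)` (activate with `letI`). [cite: Lang1990, Ch. 5 §1] -/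
@[reducible] def quotModuleCoeff : Module (padicCoeffIntegers S) (D.H ⧸ D.kerProj n k) :=
  Module.compHom _ ((PowerSeries.C : PowerSeries (padicCoeffIntegers S) →+* IwasawaAlgebraO₂ S).comp
    (PowerSeries.C : padicCoeffIntegers S →+* PowerSeries (padicCoeffIntegers S)))

/-- **The level embedding `H ⧸ ker (proj n k) → H^i(G_S(K̃_n), 𝒪 ⊗ μ_{p^k} ⊗ θ)`, `𝒪`-linear** (for `levelModuleO`; (P7)). [cite: JohnsonLeungKings2011, §4.2 (arXiv p0012:L109–112)] -/
def quotProj :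
    letI := quotModuleCoeff D n k
    letI := levelModuleO S (suppPF p 𝔣) θ (JohnsonLeungKings2011.pairLayerSubgroup κ₁ κ₂ n) k i
    (D.H ⧸ D.kerProj n k) →ₗ[padicCoeffIntegers S] layerCohO S κ₁ κ₂ θ 𝔣 n k i := by
  letI := quotModuleCoeff D n k
  letI := levelModuleO S (suppPF p 𝔣) θ (JohnsonLeungKings2011.pairLayerSubgroup κ₁ κ₂ n) k i
  exact
    { toFun := QuotientAddGroup.lift (D.kerProj n k).toAddSubgroup (D.proj n k) fun x hx ↦ hx
      map_add' := fun x y ↦ map_add _ x y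
      map_smul' := fun c x ↦ by
        obtain ⟨x, rfl⟩ := Submodule.Quotient.mk_surjective _ x
        change D.proj n k ((PowerSeries.C (PowerSeries.C c : PowerSeries (padicCoeffIntegers S)) : IwasawaAlgebraO₂ S) • x) =
          levelScalarO S (suppPF p 𝔣) θ (JohnsonLeungKings2011.pairLayerSubgroup κ₁ κ₂ n) k i c (D.proj n k x)
        exact D.proj_C_smul c n k x }

/-- The level embedding on classes: `quotProj [x] = proj n k x`. [cite: JohnsonLeungKings2011, §4.2 (arXiv p0012:L109–112)] -/
theorem quotProj_mk (x : D.H) :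
    (letI := quotModuleCoeff D n k
     letI := levelModuleO S (suppPF p 𝔣) θ (JohnsonLeungKings2011.pairLayerSubgroup κ₁ κ₂ n) k i
     quotProj D n k (Submodule.Quotient.mk x)) = D.proj n k x := rfl

/-- The level embedding is injective ((P8): its kernel is `ker (proj n k)`). [cite: Kato2004Asterisque, §8.2 (p. 180)] -/
theorem quotProj_injective :
    letI := quotModuleCoeff D n k
    letI := levelModuleO S (suppPF p 𝔣) θ (JohnsonLeungKings2011.pairLayerSubgroup κ₁ κ₂ n) k i
    Function.Injective (quotProj D n k) := by
  letI := quotModuleCoeff D n k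
  letI := levelModuleO S (suppPF p 𝔣) θ (JohnsonLeungKings2011.pairLayerSubgroup κ₁ κ₂ n) k i
  intro x y hxy
  obtain ⟨x, rfl⟩ := Submodule.Quotient.mk_surjective _ x
  obtain ⟨y, rfl⟩ := Submodule.Quotient.mk_surjective _ y
  rw [← sub_eq_zero, ← Submodule.Quotient.mk_sub, Submodule.Quotient.mk_eq_zero]
  change D.proj n k (x - y) = 0
  rw [map_sub, sub_eq_zero]
  exact hxy

include hi in
/-- ★★ **RIGIDITY OF THE PINS (two variables): `proj n k (F • x) = F • proj n k x`** for EVERY `F ∈ Λ_{𝒪,2} = 𝒪⟦T₂⟧⟦T₁⟧`, the right-hand side through the CONSTRUCTED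
`Λ_{𝒪,2}`-structure `layerModuleO₂` of the level group (honda g22, p777117), for ANY pinned datum `D` (`i ≤ 2`): the quotient `H ⧸ ker (proj n k)` embeds `𝒪`-linearly
into the level, `T₁`/`T₂` act on it through the locally nilpotent `conj_{γ_i} − 1` ((P5)–(P6)), so Kaplansky's statement (a) (`LocallyNilpotent.map_smul₂_of_comp_eq`) applies.
[cite: Kaplansky1954, §19 statement (a) (PDF p. 76)] [cite: Lang1990, Ch. 5 §1] [cite: JohnsonLeungKings2011, §4.2 Def. 4.2 (94) (arXiv p0012:L80–112)] -/
theorem proj_smul_eq_layer_smul (F : IwasawaAlgebraO₂ S) (x : D.H) :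
    D.proj n k (F • x) = (letI := layerModuleO₂ S κ₁ κ₂ γ₁ γ₂ θ 𝔣 hi n k; F • D.proj n k x) := by
  letI iC := quotModuleCoeff D n k
  letI iI := quotModuleInner D n k
  letI j0 := levelModuleO S (suppPF p 𝔣) θ (JohnsonLeungKings2011.pairLayerSubgroup κ₁ κ₂ n) k i
  letI j1 := layerModuleO₁ S κ₁ κ₂ γ₁ γ₂ θ 𝔣 hi n k
  letI j2 := layerModuleO₂ S κ₁ κ₂ γ₁ γ₂ θ 𝔣 hi n k
  obtain ⟨hC₀', hC', hX₂', hX₁'⟩ := layerModuleO_spec S κ₁ κ₂ γ₁ γ₂ θ 𝔣 hi n k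
  obtain ⟨-, h₁', h₂'⟩ := layerPsiO_comm_and_locallyNilpotent S κ₁ κ₂ γ₁ γ₂ θ 𝔣 n k hi
  -- the two operators on the quotient, as `𝒪`-linear maps
  let ψ₁ : Module.End (padicCoeffIntegers S) (D.H ⧸ D.kerProj n k) :=
    { toFun := fun v ↦ (PowerSeries.X : IwasawaAlgebraO₂ S) • v
      map_add' := fun v w ↦ smul_add _ v w
      map_smul' := fun c v ↦ by
        change (PowerSeries.X : IwasawaAlgebraO₂ S) • ((PowerSeries.C (PowerSeries.C c : PowerSeries (padicCoeffIntegers S)) : IwasawaAlgebraO₂ S) • v) =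
          (PowerSeries.C (PowerSeries.C c : PowerSeries (padicCoeffIntegers S)) : IwasawaAlgebraO₂ S) • ((PowerSeries.X : IwasawaAlgebraO₂ S) • v)
        rw [← mul_smul, mul_comm, mul_smul] }
  let ψ₂ : Module.End (padicCoeffIntegers S) (D.H ⧸ D.kerProj n k) :=
    { toFun := fun v ↦ (PowerSeries.C (PowerSeries.X : PowerSeries (padicCoeffIntegers S)) : IwasawaAlgebraO₂ S) • v
      map_add' := fun v w ↦ smul_add _ v w
      map_smul' := fun c v ↦ by
        change (PowerSeries.C PowerSeries.X : IwasawaAlgebraO₂ S) • ((PowerSeries.C (PowerSeries.C c : PowerSeries (padicCoeffIntegers S)) : IwasawaAlgebraO₂ S) • v) =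
          (PowerSeries.C (PowerSeries.C c : PowerSeries (padicCoeffIntegers S)) : IwasawaAlgebraO₂ S) • ((PowerSeries.C PowerSeries.X : IwasawaAlgebraO₂ S) • v)
        rw [← mul_smul, mul_comm, mul_smul] }
  -- the embedding intertwines `ψ_i` with `layerPsiO γ_i` ((P5), (P6))
  have hf₁ : ∀ v, quotProj D n k (ψ₁ v) = layerPsiO S κ₁ κ₂ θ 𝔣 n k i γ₁ (quotProj D n k v) := by
    intro v
    obtain ⟨x, rfl⟩ := Submodule.Quotient.mk_surjective _ v
    change quotProj D n k (Submodule.Quotient.mk ((PowerSeries.X : IwasawaAlgebraO₂ S) • x)) = _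
    rw [quotProj_mk, quotProj_mk D n k x, D.proj_T₁_smul, layerPsiO_apply]
  have hf₂ : ∀ v, quotProj D n k (ψ₂ v) = layerPsiO S κ₁ κ₂ θ 𝔣 n k i γ₂ (quotProj D n k v) := by
    intro v
    obtain ⟨x, rfl⟩ := Submodule.Quotient.mk_surjective _ v
    change quotProj D n k (Submodule.Quotient.mk ((PowerSeries.C (PowerSeries.X : PowerSeries (padicCoeffIntegers S)) : IwasawaAlgebraO₂ S) • x)) = _
    rw [quotProj_mk, quotProj_mk D n k x, D.proj_T₂_smul, layerPsiO_apply]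
  -- local nilpotency transfers along the injective embedding
  have hpow₁ : ∀ (m : ℕ) (v), quotProj D n k ((ψ₁ ^ m) v) = (layerPsiO S κ₁ κ₂ θ 𝔣 n k i γ₁ ^ m) (quotProj D n k v) := by
    intro m v
    induction m generalizing v with
    | zero => rfl
    | succ m ih => rw [pow_succ, pow_succ, Module.End.mul_apply, Module.End.mul_apply, ih, hf₁]
  have hpow₂ : ∀ (m : ℕ) (v), quotProj D n k ((ψ₂ ^ m) v) = (layerPsiO S κ₁ κ₂ θ 𝔣 n k i γ₂ ^ m) (quotProj D n k v) := by
    intro m v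
    induction m generalizing v with
    | zero => rfl
    | succ m ih => rw [pow_succ, pow_succ, Module.End.mul_apply, Module.End.mul_apply, ih, hf₂]
  have h₁ : ∀ v, ∃ m : ℕ, (ψ₁ ^ m) v = 0 := fun v ↦ by
    obtain ⟨m, hm⟩ := h₁' (quotProj D n k v)
    exact ⟨m, quotProj_injective D n k (by rw [hpow₁, hm, map_zero])⟩
  have h₂ : ∀ v, ∃ m : ℕ, (ψ₂ ^ m) v = 0 := fun v ↦ by
    obtain ⟨m, hm⟩ := h₂' (quotProj D n k v)
    exact ⟨m, quotProj_injective D n k (by rw [hpow₂, hm, map_zero])⟩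
  -- Kaplansky (a), two variables, along the embedding
  have key := map_smul₂_of_comp_eq (R := padicCoeffIntegers S) (V := D.H ⧸ D.kerProj n k) (W := layerCohO S κ₁ κ₂ θ 𝔣 n k i)
    (ψ₁ := ψ₁) (ψ₂ := ψ₂) (fun _ _ ↦ rfl) (fun _ _ ↦ rfl) (fun _ ↦ rfl) (fun _ ↦ rfl) hC₀' hC' hX₂' hX₁' h₁ h₂ (quotProj D n k) hf₁ hf₂ F
    (Submodule.Quotient.mk x)
  rw [← Submodule.Quotient.mk_smul, quotProj_mk, quotProj_mk] at key
  exact key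

include hi in
/-- ★ **Rigidity: an additive map between two pinned data (same parameters) commuting with the projections is `Λ_{𝒪,2}`-LINEAR** ((P3) on the target + the level
reading `proj_smul_eq_layer_smul` on both sides). [cite: Kaplansky1954, §19 statement (a) (PDF p. 76)] [cite: JohnsonLeungKings2011, §4.2 Def. 4.2 (94) (arXiv p0012:L80–112)] -/
theorem addMonoidHom_map_smul_of_proj (D' : IwasawaCohomologyDataO S κ₁ κ₂ γ₁ γ₂ θ 𝔣 i) (e : D.H →+ D'.H)
    (he : ∀ (n k : ℕ) (x : D.H), D'.proj n k (e x) = D.proj n k x) (F : IwasawaAlgebraO₂ S) (x : D.H) : e (F • x) = F • e x := by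
  refine sub_eq_zero.mp (D'.proj_injective _ fun n k ↦ ?_)
  rw [map_sub, he, proj_smul_eq_layer_smul hi D n k, proj_smul_eq_layer_smul hi D' n k, he, sub_self]

end TwoVar

/-! ## §2 One variable: `CycIwasawaCohomologyDataO` -/

section OneVar

variable {K : Type} [Field K] [NumberField K] {p : ℕ} [Fact p.Prime] {S : Set (PadicAlgCl p)}
  {κ : ZpExtension K p} {γ : absoluteGaloisGroup K} {θ : absoluteGaloisGroup K →ₜ* (padicCoeffIntegers S)ˣ} {P : Set (HeightOneSpectrum (𝓞 K))}
  {i : ℕ} (hi : i ≤ 2) (D : CycIwasawaCohomologyDataO S κ γ θ P i) (n k : ℕ)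

/-- **The kernel of `proj n k` as a `Λ_𝒪`-submodule** ((P8) packaged). [cite: Kato2004Asterisque, §8.2 (p. 180)] -/
def cycKerProj : Submodule (IwasawaAlgebraO S) D.H where
  carrier := {x | D.proj n k x = 0}
  zero_mem' := map_zero _
  add_mem' {x y} hx hy := by
    change D.proj n k (x + y) = 0
    rw [map_add, hx, hy, add_zero]
  smul_mem' f x hx := D.proj_smul_eq_zero n k f x hx

/-- Membership in `cycKerProj` (unfolding). [cite: Kato2004Asterisque, §8.2 (p. 180)] -/
@[simp] theorem mem_cycKerProj_iff (x : D.H) : x ∈ cycKerProj D n k ↔ D.proj n k x = 0 := Iff.rfl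

/-- The `𝒪`-structure of the quotient `H ⧸ ker (proj n k)`: restriction along `C : 𝒪 → 𝒪⟦T⟧` (activate with `letI`). [cite: Lang1990, Ch. 5 §1] -/
@[reducible] def cycQuotModuleCoeff : Module (padicCoeffIntegers S) (D.H ⧸ cycKerProj D n k) :=
  Module.compHom _ (PowerSeries.C : padicCoeffIntegers S →+* IwasawaAlgebraO S)

/-- **The level embedding `H ⧸ ker (proj n k) → H^i(G_P(K_n), 𝒪 ⊗ μ_{p^k} ⊗ θ)`, `𝒪`-linear** ((P7)). [cite: JohnsonLeungKings2011, §4.2 (arXiv p0012:L109–112)] -/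
def cycQuotProj :
    letI := cycQuotModuleCoeff D n k
    letI := levelModuleO S P θ (κ.layerSubgroup n) k i
    (D.H ⧸ cycKerProj D n k) →ₗ[padicCoeffIntegers S] cycLayerCohO S κ θ P n k i := by
  letI := cycQuotModuleCoeff D n k
  letI := levelModuleO S P θ (κ.layerSubgroup n) k i
  exact
    { toFun := QuotientAddGroup.lift (cycKerProj D n k).toAddSubgroup (D.proj n k) fun x hx ↦ hx
      map_add' := fun x y ↦ map_add _ x y
      map_smul' := fun c x ↦ by
        obtain ⟨x, rfl⟩ := Submodule.Quotient.mk_surjective _ x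
        change D.proj n k ((PowerSeries.C c : IwasawaAlgebraO S) • x) = levelScalarO S P θ (κ.layerSubgroup n) k i c (D.proj n k x)
        exact D.proj_C_smul c n k x }

/-- The level embedding on classes: `cycQuotProj [x] = proj n k x`. [cite: JohnsonLeungKings2011, §4.2 (arXiv p0012:L109–112)] -/
theorem cycQuotProj_mk (x : D.H) :
    (letI := cycQuotModuleCoeff D n k
     letI := levelModuleO S P θ (κ.layerSubgroup n) k i
     cycQuotProj D n k (Submodule.Quotient.mk x)) = D.proj n k x := rfl

/-- The level embedding is injective ((P8)). [cite: Kato2004Asterisque, §8.2 (p. 180)] -/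
theorem cycQuotProj_injective :
    letI := cycQuotModuleCoeff D n k
    letI := levelModuleO S P θ (κ.layerSubgroup n) k i
    Function.Injective (cycQuotProj D n k) := by
  letI := cycQuotModuleCoeff D n k
  letI := levelModuleO S P θ (κ.layerSubgroup n) k i
  intro x y hxy
  obtain ⟨x, rfl⟩ := Submodule.Quotient.mk_surjective _ x
  obtain ⟨y, rfl⟩ := Submodule.Quotient.mk_surjective _ y
  rw [← sub_eq_zero, ← Submodule.Quotient.mk_sub, Submodule.Quotient.mk_eq_zero, mem_cycKerProj_iff, map_sub, sub_eq_zero]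
  exact hxy

include hi in
/-- ★★ **RIGIDITY OF THE PINS (one variable): `proj n k (F • x) = F • proj n k x`** for EVERY `F ∈ Λ_𝒪 = 𝒪⟦T⟧`, the right-hand side through the CONSTRUCTED
`Λ_𝒪`-structure `cycLayerModuleO` of the level group (p782087), for ANY pinned datum `D` (`i ≤ 2`) — Kaplansky's statement (a) (`LocallyNilpotent.map_smul_of_comp_eq`) along
the `𝒪`-linear level embedding of `H ⧸ ker (proj n k)`, on which `T` acts through the locally nilpotent `conj_γ − 1` ((P5)).
[cite: Kaplansky1954, §19 statement (a) (PDF p. 76)] [cite: Lang1990, Ch. 5 §1] [cite: Kato2004Asterisque, §8.2 (p. 180)] -/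
theorem proj_smul_eq_cycLayer_smul (F : IwasawaAlgebraO S) (x : D.H) :
    D.proj n k (F • x) = (letI := cycLayerModuleO S κ γ θ P hi n k; F • D.proj n k x) := by
  letI iC := cycQuotModuleCoeff D n k
  letI j0 := levelModuleO S P θ (κ.layerSubgroup n) k i
  letI j2 := cycLayerModuleO S κ γ θ P hi n k
  obtain ⟨hC', hX'⟩ := cycLayerModuleO_spec S κ γ θ P hi n k
  let ψ : Module.End (padicCoeffIntegers S) (D.H ⧸ cycKerProj D n k) :=
    { toFun := fun v ↦ (PowerSeries.X : IwasawaAlgebraO S) • v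
      map_add' := fun v w ↦ smul_add _ v w
      map_smul' := fun c v ↦ by
        change (PowerSeries.X : IwasawaAlgebraO S) • ((PowerSeries.C c : IwasawaAlgebraO S) • v) =
          (PowerSeries.C c : IwasawaAlgebraO S) • ((PowerSeries.X : IwasawaAlgebraO S) • v)
        rw [← mul_smul, mul_comm, mul_smul] }
  have hf : ∀ v, cycQuotProj D n k (ψ v) = cycLayerPsiO S κ θ P n k i γ (cycQuotProj D n k v) := by
    intro v
    obtain ⟨x, rfl⟩ := Submodule.Quotient.mk_surjective _ v
    change cycQuotProj D n k (Submodule.Quotient.mk ((PowerSeries.X : IwasawaAlgebraO S) • x)) = _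
    rw [cycQuotProj_mk, cycQuotProj_mk D n k x, D.proj_X_smul, cycLayerPsiO_apply]
  have hpow : ∀ (m : ℕ) (v), cycQuotProj D n k ((ψ ^ m) v) = (cycLayerPsiO S κ θ P n k i γ ^ m) (cycQuotProj D n k v) := by
    intro m v
    induction m generalizing v with
    | zero => rfl
    | succ m ih => rw [pow_succ, pow_succ, Module.End.mul_apply, Module.End.mul_apply, ih, hf]
  have h : ∀ v, ∃ m : ℕ, (ψ ^ m) v = 0 := fun v ↦ by
    obtain ⟨m, hm⟩ := cycLayerPsiO_locallyNilpotent S κ γ θ P n k hi (cycQuotProj D n k v)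
    exact ⟨m, cycQuotProj_injective D n k (by rw [hpow, hm, map_zero])⟩
  have key := map_smul_of_comp_eq (R := padicCoeffIntegers S) (V := D.H ⧸ cycKerProj D n k) (W := cycLayerCohO S κ θ P n k i) (T := ψ)
    (fun _ _ ↦ rfl) (fun _ ↦ rfl) hC' hX' h (cycQuotProj D n k) hf F (Submodule.Quotient.mk x)
  rw [← Submodule.Quotient.mk_smul, cycQuotProj_mk, cycQuotProj_mk] at key
  exact key

include hi in
/-- ★ **Rigidity (one variable): an additive map between two pinned data commuting with the projections is `Λ_𝒪`-LINEAR.**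
[cite: Kaplansky1954, §19 statement (a) (PDF p. 76)] [cite: Kato2004Asterisque, §8.2 (p. 180)] -/
theorem addMonoidHom_map_smul_of_proj_cyc (D' : CycIwasawaCohomologyDataO S κ γ θ P i) (e : D.H →+ D'.H)
    (he : ∀ (n k : ℕ) (x : D.H), D'.proj n k (e x) = D.proj n k x) (F : IwasawaAlgebraO S) (x : D.H) : e (F • x) = F • e x := by
  refine sub_eq_zero.mp (D'.proj_injective _ fun n k ↦ ?_)
  rw [map_sub, he, proj_smul_eq_cycLayer_smul hi D n k, proj_smul_eq_cycLayer_smul hi D' n k, he, sub_self]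

end OneVar

end Summit.BirchSwinnertonDyer.BirchSwinnertonDyer.Theorems.SmallImageRttD2J2

end
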